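import Literature.NumberTheory.Rogawski1990.ArchGlobalStableOrbitalWallDeriv        -- ★ (δ) (this seat): the global jump formula modulo `hJ`; brings J1 ★ p840417
import Literature.NumberTheory.Rogawski1990.ArchLimitFormulaNoncompactWallProof      -- ★ p840819 (d3b) F0P3a-p06: `archLimitFormulaNoncompactWall_holds` — the (J-nc) letter PROVED for CM `L`
import HarnessLib

/-!
# The two-wall jump formulas WITHOUT the (J-nc) hypothesis: J1 (per place) and (δ) (global stable orbital integral) made unconditional for CM fields
# ((γ) = J1 ED. 2 by import; Rogawski 1990 §8.2 p. 122–124 (P3)(P4), §14.5 p. 238–239)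

Topic `NumberTheory/Rogawski1990`; namespace `Literature.NumberTheory.Rogawski1990`.  THEOREMS ONLY (no `def`, no instance, no notation, no axiom, no `sorry`).
Cell `pub/hodgecm-mathlib`, ENGINE T1 (crux H413 = `stmt-HodgeConjecture-24833`); floor-2 road «(J-nc) in-house», brick (γ) (LEAD F0P3a-plan (g9) WORD T8-44 (A):
«J1 ED. 2 UNCONDITIONAL … fires BY IMPORT the minute p06's (d3b) `archLimitFormulaNoncompactWall_holds` is ★», 2026-09-01; author F0P3a-p07 (g7)).  A separate module rather
than an append-only edition of ★ p840417 ∕ ★ (δ): the discharge needs `import …ArchLimitFormulaNoncompactWallProof` (the whole (d1)(d2′)(d3) descent + (R1G) + (HB) chain),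
which the hypothesis-carrying files should not acquire.

WHAT IS PROVED (one line each, by import).
* `exists_tendsto_deriv_sin_mul_sum_integral_comp_conj_splitCurve_comp_perm_of_isCMField` — J1 ★ `exists_tendsto_deriv_sin_mul_sum_integral_comp_conj_splitCurve_comp_perm`
  with its letter hypothesis `hJ : ∀ τ, re σ_w(α_{τ0})·re σ_w(α_{τ2}) < 0 → ArchLimitFormulaNoncompactWall L (α ∘ τ) w` DISCHARGED by ★ `archLimitFormulaNoncompactWall_holds L (α ∘ τ) w`
  (F0P3a-p06 (g10), p840819) — for a CM field `L` (`[NumberField L] [IsCMField L]`, the route's case) the per-place two-wall jump formula holds outright.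
* `exists_tendsto_deriv_sin_mul_archStableOrbitalIntegral_update_splitCurve_of_isCMField` — the same for ★ (δ) `exists_tendsto_deriv_sin_mul_archStableOrbitalIntegral_update_splitCurve`
  (the GLOBAL stable torus orbital integral along the curve moving one indefinite place).
Statements are the ★ ones VERBATIM minus the binder `hJ` (J1 additionally acquires `[NumberField L] [IsCMField L]`).
HONEST LABEL: HC_CM is proved only modulo the 7 printed citations until rung 0 closes; this file is a two-line corollary and pays nothing by itself.

## References
* [Rogawski1990] J. D. Rogawski, *Automorphic Representations of Unitary Groups in Three Variables*, Ann. of Math. Stud. 123 (1990), §8.2 p. 122–124 ((P3), (P4)),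
  §14.5 p. 238–239 («method of §8.2»).
* [Varadarajan1989] V. S. Varadarajan, *An Introduction to Harmonic Analysis on Semisimple Lie Groups* (1989), §6.4 Thm 22 (jump relations).
-/

set_option autoImplicit false

noncomputable section

open MeasureTheory Measure Filter Topology NumberField NumberField.InfinitePlace NumberField.mixedEmbedding Equiv Function Set
open Literature.MeasureTheory.Group Literature.NumberTheory.Automorphic Literature.NumberTheory.Automorphic.UnitaryGroup
open Literature.LinearAlgebra.Matrix
open scoped Matrix MatrixGroups Matrix.Norms.Operator ContDiff

namespace Literature.NumberTheory.Rogawski1990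

variable (L : Type) [Field L] [NumberField L] [IsCMField L] (α : Fin 3 → L) (w : {w : InfinitePlace L // IsComplex w})
  [MeasurableSpace (GL (Fin 3) ℂ)] [BorelSpace (GL (Fin 3) ℂ)]

/-- **J1 UNCONDITIONAL (CM fields)**: the per-place two-wall `ψ`-derivative jump formula of ★ J1 with the (J-nc) letter hypothesis discharged by
★ `archLimitFormulaNoncompactWall_holds` (F0P3a-p06 (d3b)); statement = ★ J1 verbatim minus `hJ`. [cite: Rogawski1990, §8.2 p. 124] [cite: Varadarajan1989, §6.4 Thm 22] -/
theorem exists_tendsto_deriv_sin_mul_sum_integral_comp_conj_splitCurve_comp_perm_of_isCMField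
    (hα : ∀ i, α i ≠ 0) (hreal : ∀ i, (w.1.embedding (α i)).im = 0)
    (ν : Measure (archLocal L 3 (Matrix.diagonal α) w)) [ν.IsHaarMeasure] [ν.IsMulRightInvariant]
    (z₁ : Fin 3 → Circle) (h02 : z₁ 0 = z₁ 2) (h01 : z₁ 0 ≠ z₁ 1)
    [∀ τ : Perm (Fin 3), MeasurableSpace (archLocal L 3 (Matrix.diagonal (α ∘ ⇑τ)) w ⧸ Subgroup.centralizer
      ({(⟨circleDiagonal 3 z₁, circleDiagonal_mem_archLocal_diagonal L 3 (α ∘ ⇑τ) w z₁⟩ : archLocal L 3 (Matrix.diagonal (α ∘ ⇑τ)) w)} :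
        Set (archLocal L 3 (Matrix.diagonal (α ∘ ⇑τ)) w)))]
    [∀ τ : Perm (Fin 3), BorelSpace (archLocal L 3 (Matrix.diagonal (α ∘ ⇑τ)) w ⧸ Subgroup.centralizer
      ({(⟨circleDiagonal 3 z₁, circleDiagonal_mem_archLocal_diagonal L 3 (α ∘ ⇑τ) w z₁⟩ : archLocal L 3 (Matrix.diagonal (α ∘ ⇑τ)) w)} :
        Set (archLocal L 3 (Matrix.diagonal (α ∘ ⇑τ)) w)))]
    (νH : ∀ τ : Perm (Fin 3), Measure (Subgroup.centralizer
      ({(⟨circleDiagonal 3 z₁, circleDiagonal_mem_archLocal_diagonal L 3 (α ∘ ⇑τ) w z₁⟩ : archLocal L 3 (Matrix.diagonal (α ∘ ⇑τ)) w)} :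
        Set (archLocal L 3 (Matrix.diagonal (α ∘ ⇑τ)) w))))
    [∀ τ, (νH τ).IsHaarMeasure] [∀ τ, (νH τ).IsInvInvariant] :
    haveI : ∀ τ : Perm (Fin 3), LocallyCompactSpace (archLocal L 3 (Matrix.diagonal (α ∘ ⇑τ)) w) := fun τ => locallyCompactSpace_archLocal L 3 (Matrix.diagonal (α ∘ ⇑τ)) w
    haveI : ∀ τ : Perm (Fin 3), SecondCountableTopology (archLocal L 3 (Matrix.diagonal (α ∘ ⇑τ)) w) := fun τ => secondCountableTopology_archLocal L 3 (Matrix.diagonal (α ∘ ⇑τ)) w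
    haveI : ∀ τ : Perm (Fin 3), (ν.map (ContinuousMulEquiv.restrictSubgroup (GLn.conjEquiv (Matrix.GeneralLinearGroup.mkOfDetNeZero _ (det_monomial_one_ne_zero 3 τ)))
        (archLocal L 3 (Matrix.diagonal (α ∘ ⇑τ)) w) (archLocal L 3 (Matrix.diagonal α) w)
        (mem_archLocal_comp_perm_iff_conj_mem L 3 α w τ)).symm).IsMulRightInvariant := fun τ => isMulRightInvariant_map_relabel_symm L 3 α w τ ν
    ∃ c : Perm (Fin 3) → ℂ,
      (∀ τ : Perm (Fin 3), (w.1.embedding (α (τ 0))).re * (w.1.embedding (α (τ 2))).re < 0 → c τ ≠ 0) ∧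
      ∀ (Θ : Matrix (Fin 3) (Fin 3) ℂ → ℂ), ContDiff ℝ (⊤ : ℕ∞) Θ →
        HasCompactSupport (fun k : archLocal L 3 (Matrix.diagonal α) w => Θ ((k : GL (Fin 3) ℂ) : Matrix (Fin 3) (Fin 3) ℂ)) →
        ∀ (z₀ : Fin 3 → Circle) (h02' : z₀ 0 = z₀ 2) (h01' : z₀ 0 ≠ z₀ 1),
          Tendsto (fun ψ : ℝ => deriv (fun ψ : ℝ => (2 * Real.sin ψ : ℂ) * ∑ ρ : Perm (Fin 3), ∫ g : archLocal L 3 (Matrix.diagonal α) w,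
              Θ ((((g * ⟨circleDiagonal 3 ((fun i => z₀ i * Circle.exp (![(1 : ℝ), 0, -1] i * ψ)) ∘ ⇑ρ), circleDiagonal_mem_archLocal_diagonal L 3 α w _⟩ * g⁻¹ :
                archLocal L 3 (Matrix.diagonal α) w) : GL (Fin 3) ℂ) : Matrix (Fin 3) (Fin 3) ℂ)) ∂ν) ψ)
            (𝓝[>] 0)
            (𝓝 (∑ ρ : Perm (Fin 3),
              if 0 < (w.1.embedding (α (ρ⁻¹ 0))).re * (w.1.embedding (α (ρ⁻¹ 2))).re then
                2 * ∫ g : archLocal L 3 (Matrix.diagonal α) w,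
                  Θ ((((g * ⟨circleDiagonal 3 (z₀ ∘ ⇑ρ), circleDiagonal_mem_archLocal_diagonal L 3 α w _⟩ * g⁻¹ :
                    archLocal L 3 (Matrix.diagonal α) w) : GL (Fin 3) ℂ) : Matrix (Fin 3) (Fin 3) ℂ)) ∂ν
              else
                c ρ⁻¹ * ∫ y, descConj (⟨circleDiagonal 3 z₀, circleDiagonal_mem_archLocal_diagonal L 3 (α ∘ ⇑ρ⁻¹) w z₀⟩ : archLocal L 3 (Matrix.diagonal (α ∘ ⇑ρ⁻¹)) w)
                  (Subgroup.centralizer ({(⟨circleDiagonal 3 z₁, circleDiagonal_mem_archLocal_diagonal L 3 (α ∘ ⇑ρ⁻¹) w z₁⟩ :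
                    archLocal L 3 (Matrix.diagonal (α ∘ ⇑ρ⁻¹)) w)} : Set (archLocal L 3 (Matrix.diagonal (α ∘ ⇑ρ⁻¹)) w)))
                  (forall_mem_centralizer_circleDiagonal_comm_of_wall L (α ∘ ⇑ρ⁻¹) w h02 h01 h02' h01')
                  (fun k : archLocal L 3 (Matrix.diagonal (α ∘ ⇑ρ⁻¹)) w =>
                    Θ ((monomial ρ⁻¹ fun _ : Fin 3 => (1 : ℂ)) * ((k : GL (Fin 3) ℂ) : Matrix (Fin 3) (Fin 3) ℂ) *
                      (((Matrix.GeneralLinearGroup.mkOfDetNeZero _ (det_monomial_one_ne_zero 3 ρ⁻¹))⁻¹ : GL (Fin 3) ℂ) : Matrix (Fin 3) (Fin 3) ℂ))) y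
                  ∂(quotientMeasure _ (νH ρ⁻¹) (isClosed_coe_centralizer_singleton _)
                    (ν.map (ContinuousMulEquiv.restrictSubgroup (GLn.conjEquiv (Matrix.GeneralLinearGroup.mkOfDetNeZero _ (det_monomial_one_ne_zero 3 ρ⁻¹)))
                      (archLocal L 3 (Matrix.diagonal (α ∘ ⇑ρ⁻¹)) w) (archLocal L 3 (Matrix.diagonal α) w)
                      (mem_archLocal_comp_perm_iff_conj_mem L 3 α w ρ⁻¹)).symm)))) :=
  exists_tendsto_deriv_sin_mul_sum_integral_comp_conj_splitCurve_comp_perm L α w hα hreal (fun τ _ => archLimitFormulaNoncompactWall_holds L (α ∘ ⇑τ) w)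
    ν z₁ h02 h01 νH

variable [MeasurableSpace (arch (↥(maximalRealSubfield L)) L (IsCMField.complexConj L) 3 (Matrix.diagonal α))] [BorelSpace (arch (↥(maximalRealSubfield L)) L (IsCMField.complexConj L) 3 (Matrix.diagonal α))]

open scoped Classical in
/-- **(δ) UNCONDITIONAL (CM fields)**: the `ψ`-derivative jump of the GLOBAL stable torus orbital integral `2 sin ψ · Φ^st_∞(t(z^ψ), Θ∘↑↑·)` at a split-singular wall of one
indefinite place, ★ (δ) with the (J-nc) letter hypothesis discharged by ★ `archLimitFormulaNoncompactWall_holds`; statement = ★ (δ) verbatim minus `hJ`.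
[cite: Rogawski1990, §8.2 p. 124; §14.5 p. 238] [cite: Varadarajan1989, §6.4 Thm 22] -/
theorem exists_tendsto_deriv_sin_mul_archStableOrbitalIntegral_update_splitCurve_of_isCMField
    (hα : ∀ i, α i ≠ 0) (hherm : ∀ i, (IsCMField.complexConj L (α i) : L) = α i)
    (νw : ∀ v : {w : InfinitePlace L // IsComplex w}, Measure (archLocal L 3 (Matrix.diagonal α) v)) [∀ v, (νw v).IsHaarMeasure]
    (ν : Measure (archLocal L 3 (Matrix.diagonal α) w)) [ν.IsHaarMeasure] [ν.IsMulRightInvariant] (hνw : νw w = ν)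
    [∀ g : arch (↥(maximalRealSubfield L)) L (IsCMField.complexConj L) 3 (Matrix.diagonal α), MeasurableSpace (arch (↥(maximalRealSubfield L)) L (IsCMField.complexConj L) 3 (Matrix.diagonal α) ⧸ Subgroup.centralizer ({g} : Set (arch (↥(maximalRealSubfield L)) L (IsCMField.complexConj L) 3 (Matrix.diagonal α))))]
    [∀ g : arch (↥(maximalRealSubfield L)) L (IsCMField.complexConj L) 3 (Matrix.diagonal α), BorelSpace (arch (↥(maximalRealSubfield L)) L (IsCMField.complexConj L) 3 (Matrix.diagonal α) ⧸ Subgroup.centralizer ({g} : Set (arch (↥(maximalRealSubfield L)) L (IsCMField.complexConj L) 3 (Matrix.diagonal α))))]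
    (νinf : Measure (arch (↥(maximalRealSubfield L)) L (IsCMField.complexConj L) 3 (Matrix.diagonal α))) [νinf.IsHaarMeasure] [νinf.IsMulRightInvariant]
    (hνinf : νinf = (Measure.pi νw).map (archPiEquivCM 3 L (Matrix.diagonal α)).symm)
    {m : OrbitalMeasureFamily ↥(arch (↥(maximalRealSubfield L)) L (IsCMField.complexConj L) 3 (Matrix.diagonal α))}
    (hm : m.IsCanonical (fun γ => IsRegularElt (γ.val : GL (Fin 3) (mixedSpace L))) νinf)
    (z₁ : Fin 3 → Circle) (h02 : z₁ 0 = z₁ 2) (h01 : z₁ 0 ≠ z₁ 1)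
    [∀ τ : Perm (Fin 3), MeasurableSpace (archLocal L 3 (Matrix.diagonal (α ∘ ⇑τ)) w ⧸ Subgroup.centralizer
      ({(⟨circleDiagonal 3 z₁, circleDiagonal_mem_archLocal_diagonal L 3 (α ∘ ⇑τ) w z₁⟩ : archLocal L 3 (Matrix.diagonal (α ∘ ⇑τ)) w)} :
        Set (archLocal L 3 (Matrix.diagonal (α ∘ ⇑τ)) w)))]
    [∀ τ : Perm (Fin 3), BorelSpace (archLocal L 3 (Matrix.diagonal (α ∘ ⇑τ)) w ⧸ Subgroup.centralizer
      ({(⟨circleDiagonal 3 z₁, circleDiagonal_mem_archLocal_diagonal L 3 (α ∘ ⇑τ) w z₁⟩ : archLocal L 3 (Matrix.diagonal (α ∘ ⇑τ)) w)} :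
        Set (archLocal L 3 (Matrix.diagonal (α ∘ ⇑τ)) w)))]
    (νH : ∀ τ : Perm (Fin 3), Measure (Subgroup.centralizer
      ({(⟨circleDiagonal 3 z₁, circleDiagonal_mem_archLocal_diagonal L 3 (α ∘ ⇑τ) w z₁⟩ : archLocal L 3 (Matrix.diagonal (α ∘ ⇑τ)) w)} :
        Set (archLocal L 3 (Matrix.diagonal (α ∘ ⇑τ)) w))))
    [∀ τ, (νH τ).IsHaarMeasure] [∀ τ, (νH τ).IsInvInvariant] :
    haveI : ∀ τ : Perm (Fin 3), LocallyCompactSpace (archLocal L 3 (Matrix.diagonal (α ∘ ⇑τ)) w) := fun τ => locallyCompactSpace_archLocal L 3 (Matrix.diagonal (α ∘ ⇑τ)) w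
    haveI : ∀ τ : Perm (Fin 3), SecondCountableTopology (archLocal L 3 (Matrix.diagonal (α ∘ ⇑τ)) w) := fun τ => secondCountableTopology_archLocal L 3 (Matrix.diagonal (α ∘ ⇑τ)) w
    haveI : ∀ τ : Perm (Fin 3), (ν.map (ContinuousMulEquiv.restrictSubgroup (GLn.conjEquiv (Matrix.GeneralLinearGroup.mkOfDetNeZero _ (det_monomial_one_ne_zero 3 τ)))
                      (archLocal L 3 (Matrix.diagonal (α ∘ ⇑τ)) w) (archLocal L 3 (Matrix.diagonal α) w)
                      (mem_archLocal_comp_perm_iff_conj_mem L 3 α w τ)).symm).IsMulRightInvariant := fun τ => isMulRightInvariant_map_relabel_symm L 3 α w τ ν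
    haveI : ∀ τ : Perm (Fin 3), (ν.map (ContinuousMulEquiv.restrictSubgroup (GLn.conjEquiv (Matrix.GeneralLinearGroup.mkOfDetNeZero _ (det_monomial_one_ne_zero 3 τ)))
                      (archLocal L 3 (Matrix.diagonal (α ∘ ⇑τ)) w) (archLocal L 3 (Matrix.diagonal α) w)
                      (mem_archLocal_comp_perm_iff_conj_mem L 3 α w τ)).symm).IsHaarMeasure := fun _ => ContinuousMulEquiv.isHaarMeasure_map ν _
    ∃ c : Perm (Fin 3) → ℂ,
      (∀ τ : Perm (Fin 3), (w.1.embedding (α (τ 0))).re * (w.1.embedding (α (τ 2))).re < 0 → c τ ≠ 0) ∧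
      ∀ (Θ : Matrix (Fin 3) (Fin 3) (mixedSpace L) → ℂ), ContDiff ℝ (⊤ : ℕ∞) Θ →
        HasCompactSupport (fun g : arch (↥(maximalRealSubfield L)) L (IsCMField.complexConj L) 3 (Matrix.diagonal α) => Θ ((g : GL (Fin 3) (mixedSpace L)) : Matrix (Fin 3) (Fin 3) (mixedSpace L))) →
        ∀ (z : {w : InfinitePlace L // IsComplex w} → Fin 3 → Circle) (hz : ∀ v, v ≠ w → Function.Injective (z v)) (h02' : z w 0 = z w 2) (h01' : z w 0 ≠ z w 1),
          Tendsto (fun ψ : ℝ => deriv (fun ψ : ℝ => (2 * Real.sin ψ : ℂ) *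
              archStableOrbitalIntegral L 3 (Matrix.diagonal α) m
                (fun g : arch (↥(maximalRealSubfield L)) L (IsCMField.complexConj L) 3 (Matrix.diagonal α) => Θ ((g : GL (Fin 3) (mixedSpace L)) : Matrix (Fin 3) (Fin 3) (mixedSpace L)))
                (archDiagTorus L 3 α (Function.update z w fun i => z w i * Circle.exp (![(1 : ℝ), 0, -1] i * ψ)))) ψ)
            (𝓝[>] 0)
            (𝓝 (((∏ v : {w : InfinitePlace L // IsComplex w},
                  (Finset.univ.filter fun i => 0 < (v.1.embedding (α i)).re).card.factorial *
                    (3 - (Finset.univ.filter fun i => 0 < (v.1.embedding (α i)).re).card).factorial : ℕ) : ℂ)⁻¹ *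
              ∑ ρ : {w : InfinitePlace L // IsComplex w} → Perm (Fin 3),
              if 0 < (w.1.embedding (α ((ρ w)⁻¹ 0))).re * (w.1.embedding (α ((ρ w)⁻¹ 2))).re then
                2 * ∫ g : archLocal L 3 (Matrix.diagonal α) w,
                  (fun x' : archLocal L 3 (Matrix.diagonal α) w =>
          ∫ b : (∀ w' : {v : {w : InfinitePlace L // IsComplex w} // ¬ v = w}, archLocal L 3 (Matrix.diagonal α) w'.1),
            Θ ((((archPiEquivCM 3 L (Matrix.diagonal α)).symm
              ((MeasurableEquiv.piEquivPiSubtypeProd (fun v : {w : InfinitePlace L // IsComplex w} => ↥(archLocal L 3 (Matrix.diagonal α) v)) (· = w)).symm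
                ((MeasurableEquiv.piUnique fun i : {v : {w : InfinitePlace L // IsComplex w} // v = w} => ↥(archLocal L 3 (Matrix.diagonal α) i.1)).symm x',
                  fun w' => b w' * ⟨circleDiagonal 3 (z w'.1 ∘ ⇑(ρ w'.1)), circleDiagonal_mem_archLocal_diagonal L 3 α w'.1 (z w'.1 ∘ ⇑(ρ w'.1))⟩ * (b w')⁻¹)) :
                arch (↥(maximalRealSubfield L)) L (IsCMField.complexConj L) 3 (Matrix.diagonal α)) : GL (Fin 3) (mixedSpace L)) : Matrix (Fin 3) (Fin 3) (mixedSpace L))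
            ∂(Measure.pi fun w' : {v : {w : InfinitePlace L // IsComplex w} // ¬ v = w} => νw w'.1))
          (g * ⟨circleDiagonal 3 (z w ∘ ⇑(ρ w)), circleDiagonal_mem_archLocal_diagonal L 3 α w (z w ∘ ⇑(ρ w))⟩ * g⁻¹) ∂ν
              else
                c (ρ w)⁻¹ * ∫ y, descConj (⟨circleDiagonal 3 (z w), circleDiagonal_mem_archLocal_diagonal L 3 (α ∘ ⇑(ρ w)⁻¹) w (z w)⟩ : archLocal L 3 (Matrix.diagonal (α ∘ ⇑(ρ w)⁻¹)) w)
                  (Subgroup.centralizer ({(⟨circleDiagonal 3 z₁, circleDiagonal_mem_archLocal_diagonal L 3 (α ∘ ⇑(ρ w)⁻¹) w z₁⟩ :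
                    archLocal L 3 (Matrix.diagonal (α ∘ ⇑(ρ w)⁻¹)) w)} : Set (archLocal L 3 (Matrix.diagonal (α ∘ ⇑(ρ w)⁻¹)) w)))
                  (forall_mem_centralizer_circleDiagonal_comm_of_wall L (α ∘ ⇑(ρ w)⁻¹) w h02 h01 h02' h01')
                  (fun k : archLocal L 3 (Matrix.diagonal (α ∘ ⇑(ρ w)⁻¹)) w =>
                    (fun x' : archLocal L 3 (Matrix.diagonal α) w =>
          ∫ b : (∀ w' : {v : {w : InfinitePlace L // IsComplex w} // ¬ v = w}, archLocal L 3 (Matrix.diagonal α) w'.1),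
            Θ ((((archPiEquivCM 3 L (Matrix.diagonal α)).symm
              ((MeasurableEquiv.piEquivPiSubtypeProd (fun v : {w : InfinitePlace L // IsComplex w} => ↥(archLocal L 3 (Matrix.diagonal α) v)) (· = w)).symm
                ((MeasurableEquiv.piUnique fun i : {v : {w : InfinitePlace L // IsComplex w} // v = w} => ↥(archLocal L 3 (Matrix.diagonal α) i.1)).symm x',
                  fun w' => b w' * ⟨circleDiagonal 3 (z w'.1 ∘ ⇑(ρ w'.1)), circleDiagonal_mem_archLocal_diagonal L 3 α w'.1 (z w'.1 ∘ ⇑(ρ w'.1))⟩ * (b w')⁻¹)) :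
                arch (↥(maximalRealSubfield L)) L (IsCMField.complexConj L) 3 (Matrix.diagonal α)) : GL (Fin 3) (mixedSpace L)) : Matrix (Fin 3) (Fin 3) (mixedSpace L))
            ∂(Measure.pi fun w' : {v : {w : InfinitePlace L // IsComplex w} // ¬ v = w} => νw w'.1))
          ((ContinuousMulEquiv.restrictSubgroup (GLn.conjEquiv (Matrix.GeneralLinearGroup.mkOfDetNeZero _ (det_monomial_one_ne_zero 3 (ρ w)⁻¹)))
                      (archLocal L 3 (Matrix.diagonal (α ∘ ⇑(ρ w)⁻¹)) w) (archLocal L 3 (Matrix.diagonal α) w)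
                      (mem_archLocal_comp_perm_iff_conj_mem L 3 α w (ρ w)⁻¹)) k)) y
                  ∂(quotientMeasure _ (νH (ρ w)⁻¹) (isClosed_coe_centralizer_singleton _)
                    (ν.map (ContinuousMulEquiv.restrictSubgroup (GLn.conjEquiv (Matrix.GeneralLinearGroup.mkOfDetNeZero _ (det_monomial_one_ne_zero 3 (ρ w)⁻¹)))
                      (archLocal L 3 (Matrix.diagonal (α ∘ ⇑(ρ w)⁻¹)) w) (archLocal L 3 (Matrix.diagonal α) w)
                      (mem_archLocal_comp_perm_iff_conj_mem L 3 α w (ρ w)⁻¹)).symm)))) :=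
  exists_tendsto_deriv_sin_mul_archStableOrbitalIntegral_update_splitCurve L α w hα hherm (fun τ _ => archLimitFormulaNoncompactWall_holds L (α ∘ ⇑τ) w)
    νw ν hνw νinf hνinf hm z₁ h02 h01 νH

end Literature.NumberTheory.Rogawski1990

end
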